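import Summits.AnomalousDissipation.AnomalousDissipation.Theorems.MomentParityGalerkinInvariantLoudStubKrylovBogoliubov
import Summits.AnomalousDissipation.AnomalousDissipation.Theorems.MomentLadder.Negative.Clauses

/-!
# Krylov–Bogoliubov at level `N` WITH THE RESOLUTION ROWS
# (crux stmt-AnomalousDissipation-11463, `MomentParity.MomentLadder`, line `Sketch`, one-trajectory reshape)

The landed stub S3 of the sibling line `taylor-cone-homogenisation` (crux `GalerkinInvariantLoud`, 14283),
`GalerkinInvariantLoud.KrylovBogoliubov.stub_krylovBogoliubov`, turns ONE mean-zero Galerkin datum `a` of order `N` whose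
orbit `u(t) = galerkinFlow ν f N t a` has cumulative Taylor ratio `liminf_T ν∫₀ᵀ‖∇u‖² / ∫₀ᵀ|u|² ≥ κ` into an all-order
invariant level-`N` law in the Taylor cone `κ·e(μ) ≤ D(μ)`, carried by the absorbing ball.

Here the same Cesàro cluster measure is shown to inherit, in addition, the RESOLUTION CLAUSE of `MomentLadder`
(`MomentLadder.Negative.IsResolved K μ`: `∫‖∇u‖²dμ ≤ ∫‖∇P_{K n}u‖²dμ + 1/(n+1)` for all `n`) from the corresponding
clause on the time series of ONE orbit: for every `n`, the time-averaged UNRESOLVED enstrophy beyond the wavenumber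
`K n` has `limsup_T T⁻¹∫₀ᵀ (‖∇u‖² − ‖∇P_{K n}u‖²) dt ≤ 1/(n+1)` (`krylovBogoliubov_resolved`). The unresolved enstrophy of a
level-`N` field is the continuous band sum `4π² Σ_{k ∈ ball N ∖ ball (K n)} |k|²|û(k)|²` on `H`, so each clause is a closed
constraint on the time means of a continuous observable and passes to the cluster measure (`exists_cesaro_limit`).

This is the transfer half of the ONE-TRAJECTORY currency of the crux: "per `(j, N)` one Galerkin run with Taylor ratio
`≥ κ` and `N`-uniformly resolved dissipation spectrum" ⇒ loud, bounded, resolved Galerkin-invariant laws ⇒ `MomentLadder`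
(`Theorems/MomentParityMomentLadderOneTrajectory.lean`). Folklore (Krylov–Bogoliubov 1937; FMRT 2001 Ch. IV App. B).
-/

set_option linter.dupNamespace false

noncomputable section

namespace Summit.AnomalousDissipation.AnomalousDissipation.Theorems.MomentLadder

open MeasureTheory Filter Topology Set UnitAddTorus
open scoped ENNReal InnerProductSpace RealInnerProductSpace
open Literature.Analysis.FunctionSpaces Literature.Analysis.FluidPDE
open Summit.AnomalousDissipation.AnomalousDissipation.Theses.MomentParity
open Summit.AnomalousDissipation.AnomalousDissipation.Theorems.QuarticGate.Negative
open Summit.AnomalousDissipation.AnomalousDissipation.Theorems.CubicParityLoud.Negative (T3 R3 H3 L2T3 norm_toLp_eq_sqrt)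
open Summit.AnomalousDissipation.AnomalousDissipation.Theorems.MomentParity
  (toLp_realTrigPoly_mem_energySpace nsGeneratorPairing_eq_sum_re_inner_galerkinField band_of_band₀)
open Summit.AnomalousDissipation.AnomalousDissipation.Theorems.MomentParityMomentClosure
  (exists_limit_measure_of_isCompact isCompact_levelBall continuous_nsGeneratorPairing_polyGrad nsGeneratorPairing_polyGrad
   continuous_eval_pderiv continuous_bandEnstrophy bandEnstrophy_nonneg lintegral_eGradNormSq_eq
   lintegral_eGradNormSq_fourierTruncate_eq ofReal_le_ofReal_add_inv_iff integrable_of_continuous_of_ae_mem)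
open Summit.AnomalousDissipation.AnomalousDissipation.Theorems.GalerkinInvariantLoud.Negative (IsInvariant ae_norm_le_absorbing)
open Summit.AnomalousDissipation.AnomalousDissipation.Theorems.GalerkinInvariantLoud.KrylovBogoliubov
open Summit.AnomalousDissipation.AnomalousDissipation.Theorems.MomentLadder.Negative (IsSupported IsResolved)

/-! ## The unresolved band enstrophy of a level-`N` field -/

/-- **Truncated band enstrophy is monotone on level-`N` fields**: for `u` carried by `0 < |k| ≤ N`, the band sum over
ANY ball `K` is at most the band sum over the ball `N` (the modes of `u` outside the ball `N` vanish). [folklore] -/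
theorem bandEnstrophy_le_of_isLevel {N : ℕ} (K : ℕ) {u : H3} (hu : IsLevel N u) :
    4 * Real.pi ^ 2 * ∑ k ∈ Torus.freqBall K,
        Torus.freqNormSq k * ‖mFourierCoeff (EuclideanSpace.complexify ∘ (u.1 : T3 → R3)) k‖ ^ 2 ≤
      4 * Real.pi ^ 2 * ∑ k ∈ Torus.freqBall N,
        Torus.freqNormSq k * ‖mFourierCoeff (EuclideanSpace.complexify ∘ (u.1 : T3 → R3)) k‖ ^ 2 := by
  refine mul_le_mul_of_nonneg_left ?_ (by positivity)
  have hvan : ∀ k ∈ Torus.freqBall K, k ∉ Torus.freqBall K ∩ Torus.freqBall N →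
      Torus.freqNormSq k * ‖mFourierCoeff (EuclideanSpace.complexify ∘ (u.1 : T3 → R3)) k‖ ^ 2 = 0 := by
    intro k hkK hkKN
    have hkN : k ∉ Torus.freqBall N := fun h => hkKN (Finset.mem_inter.2 ⟨hkK, h⟩)
    have hk : k ∉ (Torus.freqBall N).erase 0 := fun h => hkN (Finset.mem_of_mem_erase h)
    rw [hu k hk, norm_zero]
    ring
  calc ∑ k ∈ Torus.freqBall K,
        Torus.freqNormSq k * ‖mFourierCoeff (EuclideanSpace.complexify ∘ (u.1 : T3 → R3)) k‖ ^ 2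
      = ∑ k ∈ Torus.freqBall K ∩ Torus.freqBall N,
        Torus.freqNormSq k * ‖mFourierCoeff (EuclideanSpace.complexify ∘ (u.1 : T3 → R3)) k‖ ^ 2 :=
        (Finset.sum_subset Finset.inter_subset_left hvan).symm
    _ ≤ ∑ k ∈ Torus.freqBall N,
        Torus.freqNormSq k * ‖mFourierCoeff (EuclideanSpace.complexify ∘ (u.1 : T3 → R3)) k‖ ^ 2 :=
        Finset.sum_le_sum_of_subset_of_nonneg Finset.inter_subset_right fun k _ _ =>
          mul_nonneg (Torus.freqNormSq_nonneg k) (sq_nonneg _)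

/-- `((n : ℝ≥0∞) + 1)⁻¹ = ofReal ((n + 1)⁻¹)`. [folklore] -/
theorem inv_natCast_add_one_eq_ofReal (n : ℕ) :
    ((n : ℝ≥0∞) + 1)⁻¹ = ENNReal.ofReal (((n : ℝ) + 1)⁻¹) := by
  have hc : (0 : ℝ) < (n : ℝ) + 1 := by positivity
  rw [ENNReal.ofReal_inv_of_pos hc, ENNReal.ofReal_add (Nat.cast_nonneg n) zero_le_one,
    ENNReal.ofReal_natCast, ENNReal.ofReal_one]

/-! ## Krylov–Bogoliubov with the resolution rows -/

/-- **Krylov–Bogoliubov at level `N`, ratio form, WITH RESOLUTION.** For `ν > 0`, a smooth divergence-free mean-zero force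
`f`, a level `N`, a real `κ`, a schedule `K : ℕ → ℕ` and a mean-zero Galerkin datum `a` of order `N` whose orbit
`u(t) = galerkinFlow ν f N t a` has cumulative Taylor ratio `liminf_T ν∫₀ᵀ‖∇u‖² / ∫₀ᵀ|u|² ≥ κ` AND resolved time-averaged
enstrophy tails `limsup_T T⁻¹ ∫₀ᵀ (‖∇u‖² − ‖∇P_{K n} u‖²) ≤ 1/(n+1)` for every `n`, some Borel probability law on `H` is
level-`N` carried, carried by the absorbing ball `‖u‖ ≤ ‖f‖₂/(4π²ν)`, all-order invariant for Galerkin NS at `(ν, f)`, in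
the cone `κ·e(μ) ≤ D(μ)` and `K`-RESOLVED (`IsResolved K μ`). Same Cesàro cluster measure as
`GalerkinInvariantLoud.KrylovBogoliubov.stub_krylovBogoliubov`; the new rows are closed constraints on the time means of the
continuous unresolved band enstrophies. [folklore] -/
theorem krylovBogoliubov_resolved :
    ∀ (ν : ℝ) (f : UnitAddTorus (Fin 3) → EuclideanSpace ℝ (Fin 3)) (N : ℕ) (κ : ℝ) (K : ℕ → ℕ)
      (a : UnitAddTorus (Fin 3) → EuclideanSpace ℝ (Fin 3)),
      0 < ν → Torus.IsSmooth f → Torus.HasZeroMean f → IsGalerkinMode N a → Torus.HasZeroMean a →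
      κ ≤ Filter.liminf (fun T : ℝ =>
          (ν * (∫⁻ t in Ioo 0 T, Torus.eGradNormSq (Torus.galerkinFlow ν f N t a)).toReal) /
            (∫ t in (0 : ℝ)..T, ∫ x, ‖Torus.galerkinFlow ν f N t a x‖ ^ 2)) atTop →
      (∀ n : ℕ, Filter.limsup (fun T : ℝ => (ENNReal.ofReal T)⁻¹ *
          ∫⁻ t in Ioo 0 T, (Torus.eGradNormSq (Torus.galerkinFlow ν f N t a) -
            Torus.eGradNormSq (Torus.fourierTruncate (K n) (Torus.galerkinFlow ν f N t a)))) atTop ≤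
          ((n : ℝ≥0∞) + 1)⁻¹) →
      ∃ μ : Measure (Torus.energySpace (Fin 3)),
        IsProbabilityMeasure μ ∧ (∀ᵐ u ∂μ, IsLevel N u) ∧
        (∀ᵐ u ∂μ, ‖u‖ ≤ Real.sqrt (∫ x, ‖f x‖ ^ 2) / (4 * Real.pi ^ 2 * ν)) ∧
        (∀ d : ℕ, IsPolyStationary ν f N d μ) ∧
        κ * Torus.ensembleEnergy μ ≤ Torus.ensembleDissipation ν μ ∧
        IsResolved K μ := by
  intro ν f N κ K a hν hfs hfz ha ha0 hlim hres
  have hS : ∀ k ∈ Torus.freqBall (d := Fin 3) N, -k ∈ Torus.freqBall N := Torus.neg_mem_freqBall_of_mem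
  have hfi : Integrable f volume := hfs.integrable
  have hf2 : MemLp f 2 volume := hfs.memLp 2
  -- (A) the coefficient orbit and its lift to `H`
  set c : ℝ → ↥(Torus.freqBall (d := Fin 3) N) → EuclideanSpace ℂ (Fin 3) := fun t =>
    galerkinCoeffFlow ν (fourierRestrict (Torus.freqBall N) f) t (fourierRestrict (Torus.freqBall N) a) with hc_def
  have hc : IsGalerkinODESolution ν (fourierRestrict (Torus.freqBall N) f) (fourierRestrict (Torus.freqBall N) a) c :=
    isGalerkinODESolution_galerkinCoeffFlow hν.le hS (Torus.isRealCoeff_mFourierCoeff hfi) ha.fourierRestrict_mem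
  have hneg : ∀ t, t ≤ 0 → c t = fourierRestrict (Torus.freqBall N) a := fun t ht => galerkinCoeffFlow_of_nonpos ht
  have hcm : ∀ t, c t ∈ galerkinSubspace (Torus.freqBall N) := hc.mem
  have h0 : ∀ t, c t ⟨0, Torus.zero_mem_freqBall N⟩ = 0 := apply_zero_of_isGalerkinODESolution hfi hfz ha ha0 hc hneg
  have hu : ∀ t, Torus.galerkinFlow ν f N t a =
      Torus.realTrigPoly (Torus.freqBall N) (Torus.coeffExt (Torus.freqBall N) (c t)) := fun t => ha.galerkinFlow_eq t
  set U : ℝ → H3 := fun t =>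
    ⟨(Torus.memLp_realTrigPoly (Torus.freqBall N) (Torus.coeffExt (Torus.freqBall N) (c t)) 2).toLp _,
      (toLp_realTrigPoly_mem_energySpace (hcm t) (h0 t)).1⟩ with hU_def
  have hU : ∀ t, (U t).1 =
      (Torus.memLp_realTrigPoly (Torus.freqBall N) (Torus.coeffExt (Torus.freqBall N) (c t)) 2).toLp _ := fun t => rfl
  have hUc : Continuous U := continuous_lift hU (continuous_of_isGalerkinODESolution hc hneg)
  have hlev : ∀ t, IsLevel N (U t) := isLevel_lift hU hcm h0
  -- the uniform bound and the compact carrier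
  set M : ℝ := max (∑ k, ‖fourierRestrict (Torus.freqBall N) a k‖ ^ 2)
    ((∫ x, ‖f x‖ ^ 2) / (4 * Real.pi ^ 2 * ν) ^ 2) with hM_def
  set R : ℝ := Real.sqrt M with hR_def
  have hR : 0 ≤ R := Real.sqrt_nonneg _
  have hUR : ∀ t, ‖U t‖ ≤ R := fun t => by
    rw [hR_def, ← Real.sqrt_sq (norm_nonneg (U t)), norm_lift_sq hU hcm t]
    exact Real.sqrt_le_sqrt (energy_le_of_isGalerkinODESolution hν hf2 hc hneg h0 t)
  set Kb : Set H3 := {u : H3 | IsLevel N u ∧ ‖u‖ ≤ R} with hKb_def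
  have hKb : IsCompact Kb := isCompact_levelBall N hR
  have hUK : ∀ t, U t ∈ Kb := fun t => ⟨hlev t, hUR t⟩
  -- (B) the cluster measure of the Cesàro averages
  obtain ⟨μ', hμ'P, hμ'K, hlimμ⟩ := exists_cesaro_limit hKb hUc hUK
  haveI := hμ'P
  have hμ'L : ∀ᵐ u ∂μ', IsLevel N u := hμ'K.mono fun u hu => hu.1
  have hμ'R : ∀ᵐ u ∂μ', ‖u‖ ≤ R := hμ'K.mono fun u hu => hu.2
  -- (C1) all-order rows
  have hrow : ∀ (m : ℕ) (g : Fin m → T3 → R3) (P : MvPolynomial (Fin m) ℝ), (∀ i, IsBandTest N (g i)) →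
      Integrable (fun u => Torus.nsGeneratorPairing ν f u (polyGrad g P u)) μ' ∧
        ∫ u, Torus.nsGeneratorPairing ν f u (polyGrad g P u) ∂μ' = 0 := by
    intro m g P hg
    have hgs : ∀ i, Torus.IsSmooth (g i) := fun i => (hg i).1
    have hFc : Continuous fun u : H3 => Torus.nsGeneratorPairing ν f u (polyGrad g P u) :=
      continuous_nsGeneratorPairing_polyGrad ν hfi hgs P
    refine ⟨integrable_of_continuous_of_ae_mem hKb hμ'K hFc, ?_⟩
    have hΦc : Continuous fun u : H3 => MvPolynomial.eval (fun j => Torus.pairing u.1 (g j)) P :=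
      continuous_eval_pderiv hgs P
    obtain ⟨B, hB⟩ := hKb.exists_bound_of_continuousOn hΦc.continuousOn
    refine integral_eq_zero_of_cesaro (hlimμ _ hFc)
      (Φ := fun t => MvPolynomial.eval (fun j => Torus.pairing (U t).1 (g j)) P)
      (fun T hT => integral_nsGeneratorPairing_polyGrad_lift hc hU hcm h0 hf2 hneg hg P hT) (B := B) fun t _ => ?_
    have h := hB (U t) (hUK t)
    rwa [Real.norm_eq_abs] at h
  have hinv : IsInvariant ν f N μ' := fun m g P hg => hrow m g P hg
  -- the band enstrophies (continuous observables on `H`)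
  set bandE : ℕ → H3 → ℝ := fun L u => 4 * Real.pi ^ 2 * ∑ k ∈ Torus.freqBall L, Torus.freqNormSq k *
    ‖mFourierCoeff (EuclideanSpace.complexify ∘ ((u : H3).1 : T3 → R3)) k‖ ^ 2 with hbandE_def
  have hbc : ∀ L, Continuous (bandE L) := fun L => continuous_bandEnstrophy _
  have hb0 : ∀ L u, 0 ≤ bandE L u := fun L u => bandEnstrophy_nonneg _ u
  -- the orbit quantities in terms of the lift
  have hgrad : ∀ t, Torus.eGradNormSq (Torus.galerkinFlow ν f N t a) = ENNReal.ofReal (bandE N (U t)) := fun t => by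
    rw [hu t]
    exact eGradNormSq_realTrigPoly_eq_lift hU hcm h0 t
  have hconj : ∀ t, Torus.IsConjSymm (Torus.coeffExt (Torus.freqBall N) (c t)) := fun t =>
    (hcm t).1.isConjSymm_coeffExt hS
  have hcoefv : ∀ t k, mFourierCoeff (EuclideanSpace.complexify ∘
      Torus.realTrigPoly (Torus.freqBall N) (Torus.coeffExt (Torus.freqBall N) (c t))) k =
        mFourierCoeff (EuclideanSpace.complexify ∘ ((U t).1 : T3 → R3)) k := by
    intro t k
    rw [Torus.mFourierCoeff_realTrigPoly hS (hconj t) k, mFourierCoeff_lift hU hcm h0 t k]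
    by_cases hk : k ∈ Torus.freqBall N
    · rw [if_pos hk]
    · rw [if_neg hk, Torus.coeffExt_of_not_mem _ hk]
  have hgradK : ∀ (L : ℕ) (t : ℝ), Torus.eGradNormSq (Torus.fourierTruncate L (Torus.galerkinFlow ν f N t a)) =
      ENNReal.ofReal (bandE L (U t)) := by
    intro L t
    have hint : Integrable (Torus.realTrigPoly (Torus.freqBall N) (Torus.coeffExt (Torus.freqBall N) (c t))) volume :=
      (Torus.memLp_realTrigPoly (Torus.freqBall N) (Torus.coeffExt (Torus.freqBall N) (c t)) 2).integrable one_le_two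
    rw [hu t, Torus.fourierTruncate_eq, Torus.eGradNormSq_realTrigPoly Torus.neg_mem_freqBall_of_mem
      (Torus.isConjSymm_mFourierCoeff hint)]
    simp_rw [hcoefv t]
    rfl
  have hbandLe : ∀ (L : ℕ) (t : ℝ), bandE L (U t) ≤ bandE N (U t) := fun L t => bandEnstrophy_le_of_isLevel L (hlev t)
  refine ⟨μ', hμ'P, hμ'L, ?_, fun d m g P hg _ => hrow m g P hg, ?_, ?_⟩
  · -- (C2) the absorbing radius, from invariance
    have h := ae_norm_le_absorbing hν hf2 hμ'L hμ'R hinv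
    rwa [norm_toLp_eq_sqrt] at h
  · -- (C3) the cone inequality
    have hD : Continuous fun u => ν * bandE N u := continuous_const.mul (hbc N)
    have hE : Continuous fun u : H3 => ‖u‖ ^ 2 := continuous_norm.pow 2
    have hD0 : ∀ u, 0 ≤ ν * bandE N u := fun u => mul_nonneg hν.le (hb0 N u)
    have hE0 : ∀ u : H3, 0 ≤ ‖u‖ ^ 2 := fun u => sq_nonneg _
    have hDi : Integrable (fun u => ν * bandE N u) μ' := integrable_of_continuous_of_ae_mem hKb hμ'K hD
    have hEi : Integrable (fun u : H3 => ‖u‖ ^ 2) μ' := integrable_of_continuous_of_ae_mem hKb hμ'K hE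
    have hener : ∀ t, ∫ x, ‖Torus.galerkinFlow ν f N t a x‖ ^ 2 = ‖U t‖ ^ 2 := fun t => by
      rw [hu t, Torus.integral_norm_sq_realTrigPoly hS ((hcm t).1.isConjSymm_coeffExt hS),
        Torus.sum_coeffExt (fun _ v => ‖v‖ ^ 2), norm_lift_sq hU hcm t]
    have hnum : ∀ T, 0 ≤ T → (ν * (∫⁻ t in Ioo 0 T, Torus.eGradNormSq (Torus.galerkinFlow ν f N t a)).toReal) =
        ∫ t in (0 : ℝ)..T, ν * bandE N (U t) := by
      intro T hT
      have hint : Integrable (fun t => bandE N (U t)) (volume.restrict (Ioo 0 T)) :=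
        (((hbc N).comp hUc).integrableOn_Icc (a := 0) (b := T)).mono_set Ioo_subset_Icc_self
      simp_rw [hgrad]
      rw [← ofReal_integral_eq_lintegral_ofReal hint (ae_of_all _ fun t => hb0 N _),
        ENNReal.toReal_ofReal (integral_nonneg fun t => hb0 N _), intervalIntegral.integral_const_mul,
        intervalIntegral.integral_of_le hT, integral_Ioc_eq_integral_Ioo]
    have hκ : κ ≤ liminf (fun T : ℝ => (∫ t in (0 : ℝ)..T, ν * bandE N (U t)) / ∫ t in (0 : ℝ)..T, ‖U t‖ ^ 2) atTop := by
      refine hlim.trans_eq (liminf_congr ?_)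
      filter_upwards [eventually_ge_atTop (0 : ℝ)] with T hT
      rw [hnum T hT]
      simp_rw [hener]
    have hcone := mul_integral_le_integral_of_liminf hUc hD hE hD0 hE0 hDi hEi hlimμ hκ
    have hDμ : Torus.ensembleDissipation ν μ' = ν * ∫ u, bandE N u ∂μ' := by
      rw [hbandE_def, Torus.ensembleDissipation, Torus.ensembleEnstrophy, lintegral_eGradNormSq_eq hR hμ'K,
        ENNReal.toReal_ofReal (integral_nonneg fun u => bandEnstrophy_nonneg _ u)]
    rw [hDμ, ← integral_const_mul]
    exact hcone
  · -- (C4) the resolution rows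
    intro n
    set L : ℕ := K n with hL_def
    -- the unresolved band enstrophy beyond `L`, a continuous observable, nonnegative along the orbit
    set F : H3 → ℝ := fun u => bandE N u - bandE L u with hF_def
    have hFc : Continuous F := (hbc N).sub (hbc L)
    have hF0 : ∀ t, 0 ≤ F (U t) := fun t => sub_nonneg.2 (hbandLe L t)
    have hFi : Integrable F μ' := integrable_of_continuous_of_ae_mem hKb hμ'K hFc
    -- the time integrals of `F` are the unresolved cumulative enstrophies of the orbit
    have htail : ∀ T, 0 ≤ T → (∫⁻ t in Ioo 0 T, (Torus.eGradNormSq (Torus.galerkinFlow ν f N t a) -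
        Torus.eGradNormSq (Torus.fourierTruncate (K n) (Torus.galerkinFlow ν f N t a)))) =
          ENNReal.ofReal (∫ t in (0 : ℝ)..T, F (U t)) := by
      intro T hT
      have hint : Integrable (fun t => F (U t)) (volume.restrict (Ioo 0 T)) :=
        ((hFc.comp hUc).integrableOn_Icc (a := 0) (b := T)).mono_set Ioo_subset_Icc_self
      have hpt : ∀ t, Torus.eGradNormSq (Torus.galerkinFlow ν f N t a) -
          Torus.eGradNormSq (Torus.fourierTruncate (K n) (Torus.galerkinFlow ν f N t a)) =
            ENNReal.ofReal (F (U t)) := by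
        intro t
        rw [hgrad t, hgradK (K n) t, hF_def]
        exact (ENNReal.ofReal_sub _ (hb0 _ _)).symm
      simp_rw [hpt]
      rw [← ofReal_integral_eq_lintegral_ofReal hint (ae_of_all _ fun t => hF0 t),
        intervalIntegral.integral_of_le hT, integral_Ioc_eq_integral_Ioo]
    -- the closed constraints: `∫ F dμ' ≤ 1/(n+1) + δ` for every `δ > 0`
    have hmean : ∀ δ : ℝ, 0 < δ → ∫ u, F u ∂μ' ≤ ((n : ℝ) + 1)⁻¹ + δ := by
      intro δ hδ
      have hcT : ((n : ℝ≥0∞) + 1)⁻¹ ≠ ⊤ := ENNReal.inv_ne_top.2 (by positivity)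
      have hlt : Filter.limsup (fun T : ℝ => (ENNReal.ofReal T)⁻¹ *
          ∫⁻ t in Ioo 0 T, (Torus.eGradNormSq (Torus.galerkinFlow ν f N t a) -
            Torus.eGradNormSq (Torus.fourierTruncate (K n) (Torus.galerkinFlow ν f N t a)))) atTop <
          ((n : ℝ≥0∞) + 1)⁻¹ + ENNReal.ofReal δ :=
        (hres n).trans_lt (ENNReal.lt_add_right hcT ((ENNReal.ofReal_pos.2 hδ).ne'))
      have hev := Filter.eventually_lt_of_limsup_lt hlt
      have hevT : ∀ᶠ T : ℝ in atTop, T⁻¹ * ∫ t in (0 : ℝ)..T, F (U t) < ((n : ℝ) + 1)⁻¹ + δ := by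
        filter_upwards [hev, eventually_gt_atTop (0 : ℝ)] with T hT hT0
        have hI0 : 0 ≤ ∫ t in (0 : ℝ)..T, F (U t) := intervalIntegral.integral_nonneg hT0.le fun t _ => hF0 t
        rw [htail T hT0.le, ← ENNReal.ofReal_inv_of_pos hT0, ← ENNReal.ofReal_mul (inv_nonneg.2 hT0.le),
          inv_natCast_add_one_eq_ofReal, ← ENNReal.ofReal_add (by positivity) hδ.le] at hT
        exact (ENNReal.ofReal_lt_ofReal_iff (by positivity)).1 hT
      have hevn : ∀ᶠ m : ℕ in atTop,
          ((m : ℝ) + 1)⁻¹ * ∫ t in (0 : ℝ)..((m : ℝ) + 1), F (U t) ∈ Iic (((n : ℝ) + 1)⁻¹ + δ) := by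
        filter_upwards [(tendsto_atTop_add_const_right _ 1 tendsto_natCast_atTop_atTop).eventually hevT] with m hm
        exact le_of_lt hm
      exact hlimμ F hFc _ isClosed_Iic hevn
    have hmean0 : ∫ u, F u ∂μ' ≤ ((n : ℝ) + 1)⁻¹ := le_of_forall_pos_lt_add fun δ hδ =>
      (hmean (δ / 2) (half_pos hδ)).trans_lt (by linarith)
    -- read off the two mean enstrophies
    rw [lintegral_eGradNormSq_eq hR hμ'K, lintegral_eGradNormSq_fourierTruncate_eq hR hμ'K (K n),
      ofReal_le_ofReal_add_inv_iff (integral_nonneg fun u => hb0 _ u) n, ← integral_sub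
        (integrable_of_continuous_of_ae_mem hKb hμ'K (hbc N)) (integrable_of_continuous_of_ae_mem hKb hμ'K (hbc _))]
    exact hmean0

end Summit.AnomalousDissipation.AnomalousDissipation.Theorems.MomentLadder

end
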